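import Literature.AlgebraicGeometry.Resolution.SandwichedWeakPatching
import Literature.AlgebraicGeometry.Resolution.ProperModelsExtension
import Literature.AlgebraicGeometry.Resolution.ProperModelsRegLeification
import Literature.AlgebraicGeometry.Morphisms.NagataCompactificationProofs
import HarnessLib

/-!
# ResolutionOfSingularities / UniversalCells — crux `LocalToGlobal`, line `birth`:
# Zariski-open patching of two partial resolutions from two-model patching of proper models

Crux `stmt-ResolutionOfSingularities-15232`, decl `UniversalCells.LocalToGlobal`; line `birth`,
load-bearing stub `stub_openPatching` ("open patching": for `X` integral separated of finite type
over `𝔽_p` covered by opens `U, V`, two proper birational integral models `Z₁ → X` regular over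
`U` and `Z₂ → X` regular over `V` patch to a resolution of `X`).

This file places that stub UNDER the tree's catalogued open core of Zariski's programme,
`Literature.AlgebraicGeometry.Resolution.ProperModel.TwoModelPatching p` (Zariski 1944,
Fundamental Theorem p. 539; Piltant 2013, Prop. 5.1 with `P = P_reg`; open in dimension `≥ 4`,
Piltant 2013 p. 2), with NO local input at all:

* `hasResolution_of_twoModelPatching_of_cover` — over ANY field `k` of characteristic `p`:
  `TwoModelPatching p` + (`X = U ∪ V`, `Z₁ → X` regular over `U`, `Z₂ → X` regular over `V`)
  ⇒ `Scheme.HasResolution X`. Proof: compactify `X ⊆ X̄` (Nagata, a THEOREM of the tree: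
  `NagataCompactification_holds`, through `exists_integral_compactification`), extend `Zᵢ → X`
  to proper integral `Z̄ᵢ → X̄` cartesian over `X` (`exists_isPullback_of_nagata`), view
  `X̄, Z̄₁, Z̄₂` as proper models of the common function field `K = Frac A` through a common
  affine chart `Spec A` inside the iso-loci of both `Zᵢ → X` (`ProperModel.ofChart`), patch
  (`N → Z̄₁`, `N → Z̄₂` with `φᵢ⁻¹(Reg Z̄ᵢ) ⊆ Reg N`), observe that the two composites `N → X̄`
  coincide (uniqueness of domination, `ProperModel.Hom.f_eq`), and restrict `N → X̄` over `X`: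
  a point of `N` over `x ∈ U` maps to a point of `Z̄₁` over `x`, i.e. a point of `Z₁` over `U`,
  which is regular, so the point of `N` is regular by `RegLe`; likewise over `V` with `Z̄₂`.
* `openPatching_of_twoModelPatching` — the prime-field instance in the exact shape of the
  registered stub `stub_openPatching` of `Cruxes/LocalToGlobal/Lines/birth.lean` with its idle
  hypothesis `hloc` (pointwise-local resolvability) replaced by `ProperModel.TwoModelPatching p`:
  the line's hard stub is implied by Piltant's two-model patching over `𝔽_p`, uniformly in the
  dimension, and the local-resolvability antecedent of the crux is not used.

## References

* O. Zariski, *Reduction of the singularities of algebraic three dimensional varieties*,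
  Ann. of Math. 45 (1944) 472–542, Fundamental Theorem p. 539. [Zariski1944]
* O. Piltant, *An axiomatic version of Zariski's patching theorem*, RACSAM 107 (2013) 91–121,
  Prop. 5.1 and p. 2. [Piltant2013]
* B. Conrad, *Deligne's notes on Nagata compactifications*, J. Ramanujan Math. Soc. 22 (2007),
  Thm. 4.1. [Conrad2007]
-/

-- `Summit.<Summit>.<Sub>.Theorems` with `Sub = Summit` (single-conjunct summit, D-0017)
set_option linter.dupNamespace false

noncomputable section

open CategoryTheory CategoryTheory.Limits AlgebraicGeometry TopologicalSpace
open Literature.AlgebraicGeometry.Resolution Literature.AlgebraicGeometry.Morphisms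

namespace Summit.ResolutionOfSingularities.ResolutionOfSingularities.Theorems

universe u

/-- **Regularity over an open of the base passes to the Nagata extension.** In a cartesian square
`Z ≅ Z̄ ×_{X̄} X` (`IsPullback s g ρ O.ι` with `O ⊆ X̄` open, `s : Z → Z̄` an open immersion) where
`g = π ≫ e` for an isomorphism `e : X ≅ O`, if `Z` is regular at every point `z` with `π z ∈ U`
then `Z̄` is regular at every point `y` with `ρ y = e u` for some `u ∈ U`. [folklore] -/
theorem isRegularLocalRing_stalk_of_extension {Z Zb X Xb : Scheme.{u}} {O : Xb.Opens}
    {s : Z ⟶ Zb} [IsOpenImmersion s] {π : Z ⟶ X} (e : X ≅ (O : Scheme.{u})) {ρ : Zb ⟶ Xb}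
    (hsq : IsPullback s (π ≫ e.hom) ρ O.ι) {U : X.Opens}
    (hreg : ∀ z : Z, π.base z ∈ U → IsRegularLocalRing (Z.presheaf.stalk z))
    (y : Zb) (u : X) (hu : u ∈ U) (hy : ρ.base y = (e.hom.base u).1) :
    IsRegularLocalRing (Zb.presheaf.stalk y) := by
  refine isRegularLocalRing_stalk_of_isPullback_ι hsq
    (S := (fun x : X => (e.hom.base x).1) '' (U : Set X)) ?_ ?_ y ⟨u, hu, hy.symm⟩
  · rintro _ ⟨x, -, rfl⟩
    exact (e.hom.base x).2
  · rintro z ⟨x, hx, hzx⟩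
    apply hreg z
    have hinj : Function.Injective (fun x : X => (e.hom.base x).1) :=
      Subtype.val_injective.comp e.hom.homeomorph.injective
    have : x = π.base z := hinj (by simpa [Scheme.Hom.comp_apply] using hzx)
    rw [← this]
    exact hx

/-- **Two-model patching of proper models patches two partial resolutions over a Zariski cover.**
Let `k` be a field of characteristic `p` for which `ProperModel.TwoModelPatching p` holds, `X` an
integral separated `k`-scheme of finite type, `U ∪ V = X` an open cover, and `π₁ : Z₁ → X`,
`π₂ : Z₂ → X` proper birational morphisms from INTEGRAL schemes with `Z₁` regular at every point
over `U` and `Z₂` regular at every point over `V`. Then `X` has a resolution of singularities.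
(Compactify `X`, extend `Zᵢ` to proper models of the function field, patch, restrict over `X`;
see the module docstring.) [cite: Piltant2013, Prop. 5.1 (shape of two-model patching; this
consequence is folklore)] -/
theorem hasResolution_of_twoModelPatching_of_cover {p : ℕ} {k : Type u} [Field k] [CharP k p]
    (hT : ProperModel.TwoModelPatching.{u} p) (X : Scheme.{u}) (f : X ⟶ Spec (.of k))
    [IsSeparated f] [LocallyOfFiniteType f] [QuasiCompact f] [IsIntegral X] (U V : X.Opens)
    (hUV : U ⊔ V = ⊤) {Z₁ Z₂ : Scheme.{u}} [IsIntegral Z₁] [IsIntegral Z₂]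
    (π₁ : Z₁ ⟶ X) (π₂ : Z₂ ⟶ X) [IsProper π₁] [IsProper π₂]
    (hb₁ : IsBirational π₁) (hb₂ : IsBirational π₂)
    (hr₁ : ∀ z : Z₁, π₁.base z ∈ U → IsRegularLocalRing (Z₁.presheaf.stalk z))
    (hr₂ : ∀ z : Z₂, π₂.base z ∈ V → IsRegularLocalRing (Z₂.presheaf.stalk z)) :
    Scheme.HasResolution X := by
  classical
  have hN : NagataCompactification.{u} := NagataCompactification_holds
  /- Step 1: a common affine chart `Spec A` of `X` inside the iso-loci of `π₁` and `π₂`. -/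
  obtain ⟨O₁, hO₁d, -, hO₁iso⟩ := hb₁
  obtain ⟨O₂, hO₂d, -, hO₂iso⟩ := hb₂
  haveI := hO₁iso
  haveI := hO₂iso
  haveI : Nonempty X := inferInstance
  have hO₁₂ : ((O₁ ⊓ O₂ : X.Opens) : Set X).Nonempty := by
    obtain ⟨x, hx⟩ := hO₂d.nonempty
    obtain ⟨y, hy₂, hy₁⟩ := hO₁d.inter_open_nonempty _ O₂.isOpen ⟨x, hx⟩
    exact ⟨y, hy₁, hy₂⟩
  obtain ⟨x₀, hx₀⟩ := hO₁₂
  obtain ⟨_, ⟨W', hW, rfl⟩, hx₀W, hWO⟩ :=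
    X.isBasis_affineOpens.exists_subset_of_mem_open hx₀ (O₁ ⊓ O₂).isOpen
  let W : X.Opens := W'
  haveI : IsAffine W := hW
  haveI : Nonempty W := ⟨⟨x₀, hx₀W⟩⟩
  have hWO₁ : W ≤ O₁ := fun x hx => (hWO hx).1
  have hWO₂ : W ≤ O₂ := fun x hx => (hWO hx).2
  let A : Type u := Γ(W, ⊤)
  let fW : (W : Scheme.{u}) ⟶ Spec (.of k) := W.ι ≫ f
  let ψ : k →+* A := fW.appTop.hom.comp (Scheme.ΓSpecIso (.of k)).inv.hom
  have hψ : ψ.FiniteType := by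
    have h1 : fW.appTop.hom.FiniteType :=
      (HasRingHomProperty.iff_of_isAffine (P := @LocallyOfFiniteType)).mp inferInstance
    exact h1.comp (RingHom.FiniteType.of_surjective _
      (Scheme.ΓSpecIso (.of k)).symm.commRingCatIsoToRingEquiv.surjective)
  letI : Algebra k A := ψ.toAlgebra
  haveI hft : Algebra.FiniteType k A := hψ
  let K : Type u := FractionRing A
  haveI : Algebra.EssFiniteType k K := inferInstance
  -- the chart of `X`
  obtain ⟨jX, hjXdef⟩ : ∃ jX : Spec (.of A) ⟶ X, jX = W.toScheme.isoSpec.inv ≫ W.ι := ⟨_, rfl⟩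
  haveI : IsOpenImmersion jX := by rw [hjXdef]; infer_instance
  have hjX : jX ≫ f = Spec.map (CommRingCat.ofHom (algebraMap k A)) := by
    rw [hjXdef, Category.assoc, isoSpec_inv_comp]
    rfl
  -- the charts of `Z₁`, `Z₂`: `Spec A ≅ W ≅ πᵢ⁻¹ W ⊆ Zᵢ`
  haveI hπ₁W : IsIso (π₁ ∣_ W) := isIso_morphismRestrict_of_le π₁ hO₁iso hWO₁
  haveI hπ₂W : IsIso (π₂ ∣_ W) := isIso_morphismRestrict_of_le π₂ hO₂iso hWO₂
  obtain ⟨j₁, hj₁def⟩ : ∃ j₁ : Spec (.of A) ⟶ Z₁,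
      j₁ = W.toScheme.isoSpec.inv ≫ inv (π₁ ∣_ W) ≫ (π₁ ⁻¹ᵁ W).ι := ⟨_, rfl⟩
  obtain ⟨j₂, hj₂def⟩ : ∃ j₂ : Spec (.of A) ⟶ Z₂,
      j₂ = W.toScheme.isoSpec.inv ≫ inv (π₂ ∣_ W) ≫ (π₂ ⁻¹ᵁ W).ι := ⟨_, rfl⟩
  haveI : IsOpenImmersion j₁ := by rw [hj₁def]; infer_instance
  haveI : IsOpenImmersion j₂ := by rw [hj₂def]; infer_instance
  have hj₁π : j₁ ≫ π₁ = jX := by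
    rw [hjXdef, hj₁def, Category.assoc, Category.assoc, ← morphismRestrict_ι,
      IsIso.inv_hom_id_assoc]
  have hj₂π : j₂ ≫ π₂ = jX := by
    rw [hjXdef, hj₂def, Category.assoc, Category.assoc, ← morphismRestrict_ι,
      IsIso.inv_hom_id_assoc]
  /- Step 2: compactify `X`, extend `Z₁`, `Z₂` over the compactification. -/
  obtain ⟨Xb, sX, πX, hXb, hsX, hπX, hsXπ⟩ := exists_integral_compactification hN X f
  haveI := hXb; haveI := hsX; haveI := hπX
  haveI : IsLocallyNoetherian Xb := LocallyOfFiniteType.isLocallyNoetherian πX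
  haveI : CompactSpace Xb := QuasiCompact.compactSpace_of_compactSpace πX
  haveI : IsNoetherian Xb := {}
  let e : X ≅ (sX.opensRange : Scheme.{u}) := sX.isoOpensRange
  have he : e.hom ≫ sX.opensRange.ι = sX := Scheme.Hom.isoOpensRange_hom_ι sX
  haveI : IsProper (π₁ ≫ e.hom) := inferInstance
  haveI : IsProper (π₂ ≫ e.hom) := inferInstance
  obtain ⟨Zb₁, ρ₁, s₁, hZb₁, hρ₁, hs₁, -, hsq₁⟩ :=
    exists_isPullback_of_nagata hN sX.opensRange (π₁ ≫ e.hom)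
  obtain ⟨Zb₂, ρ₂, s₂, hZb₂, hρ₂, hs₂, -, hsq₂⟩ :=
    exists_isPullback_of_nagata hN sX.opensRange (π₂ ≫ e.hom)
  haveI := hZb₁; haveI := hρ₁; haveI := hs₁; haveI := hZb₂; haveI := hρ₂; haveI := hs₂
  have hsρ₁ : s₁ ≫ ρ₁ = π₁ ≫ sX := by rw [hsq₁.w, Category.assoc, he]
  have hsρ₂ : s₂ ≫ ρ₂ = π₂ ≫ sX := by rw [hsq₂.w, Category.assoc, he]
  /- Step 3: the three proper models of `K`. -/
  have hcX : (jX ≫ sX) ≫ πX = Spec.map (CommRingCat.ofHom (algebraMap k A)) := by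
    rw [Category.assoc, hsXπ, hjX]
  have hc₁ : (j₁ ≫ s₁) ≫ (ρ₁ ≫ πX) = Spec.map (CommRingCat.ofHom (algebraMap k A)) := by
    rw [Category.assoc, ← Category.assoc s₁, hsρ₁, Category.assoc, hsXπ, ← Category.assoc,
      hj₁π, hjX]
  have hc₂ : (j₂ ≫ s₂) ≫ (ρ₂ ≫ πX) = Spec.map (CommRingCat.ofHom (algebraMap k A)) := by
    rw [Category.assoc, ← Category.assoc s₂, hsρ₂, Category.assoc, hsXπ, ← Category.assoc,
      hj₂π, hjX]
  haveI : IsProper (ρ₁ ≫ πX) := inferInstance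
  haveI : IsProper (ρ₂ ≫ πX) := inferInstance
  let PX : ProperModel k K := ProperModel.ofChart Xb πX A (jX ≫ sX) hcX
  let P₁ : ProperModel k K := ProperModel.ofChart Zb₁ (ρ₁ ≫ πX) A (j₁ ≫ s₁) hc₁
  let P₂ : ProperModel k K := ProperModel.ofChart Zb₂ (ρ₂ ≫ πX) A (j₂ ≫ s₂) hc₂
  -- `ρᵢ` as morphisms of models `Pᵢ → PX`
  let τ₁ : P₁.Hom PX :=
    { f := ρ₁
      f_π := rfl
      gen_f := by
        change (Spec.map (CommRingCat.ofHom (algebraMap A K)) ≫ j₁ ≫ s₁) ≫ ρ₁ =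
          Spec.map (CommRingCat.ofHom (algebraMap A K)) ≫ jX ≫ sX
        rw [Category.assoc, Category.assoc, hsρ₁, ← Category.assoc j₁, hj₁π] }
  let τ₂ : P₂.Hom PX :=
    { f := ρ₂
      f_π := rfl
      gen_f := by
        change (Spec.map (CommRingCat.ofHom (algebraMap A K)) ≫ j₂ ≫ s₂) ≫ ρ₂ =
          Spec.map (CommRingCat.ofHom (algebraMap A K)) ≫ jX ≫ sX
        rw [Category.assoc, Category.assoc, hsρ₂, ← Category.assoc j₂, hj₂π] }
  /- Step 4: patch. -/
  obtain ⟨N, φ₁, φ₂, h₁, h₂⟩ := hT k K P₁ P₂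
  let χ : N.Hom PX := φ₁.comp τ₁
  have hχ₁ : χ.f = φ₁.f ≫ ρ₁ := rfl
  have hχ₂ : χ.f = φ₂.f ≫ ρ₂ := ProperModel.Hom.f_eq χ (φ₂.comp τ₂)
  /- Step 5: the resolution of `X`: `χ` restricted over `X ≅ sX(X)`. -/
  let ρ : ((χ.f ⁻¹ᵁ sX.opensRange : N.X.Opens) : Scheme.{u}) ⟶ X :=
    (χ.f ∣_ sX.opensRange) ≫ e.inv
  refine ⟨_, ρ, ⟨inferInstance, (χ.isBirational.morphismRestrict sX.opensRange).comp_iso _, ?_⟩⟩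
  intro y
  rw [SandwichedGluing.mem_regularLocus_opens_iff]
  obtain ⟨x, hx⟩ : ∃ x : X, sX x = χ.f y.1 := y.2
  have hxUV : x ∈ U ⊔ V := by rw [hUV]; trivial
  have hex : (e.hom.base x).1 = sX.base x := by
    change ((e.hom ≫ sX.opensRange.ι).base x) = sX.base x
    rw [he]
  rcases hxUV with hxU | hxV
  · -- over `U`: regular because `Z̄₁` is regular over `U` and `φ₁` is `RegLe`
    refine h₁ y.1 ?_
    change IsRegularLocalRing (Zb₁.presheaf.stalk (φ₁.f y.1))
    refine isRegularLocalRing_stalk_of_extension e hsq₁ hr₁ (φ₁.f y.1) x hxU ?_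
    change (φ₁.f ≫ ρ₁).base y.1 = _
    rw [← hχ₁, hex]
    exact hx.symm
  · -- over `V`: regular because `Z̄₂` is regular over `V` and `φ₂` is `RegLe`
    refine h₂ y.1 ?_
    change IsRegularLocalRing (Zb₂.presheaf.stalk (φ₂.f y.1))
    refine isRegularLocalRing_stalk_of_extension e hsq₂ hr₂ (φ₂.f y.1) x hxV ?_
    change (φ₂.f ≫ ρ₂).base y.1 = _
    rw [← hχ₂, hex]
    exact hx.symm

/-- **`ProperModel.TwoModelPatching p` implies the line's load-bearing stub `stub_openPatching`
over the prime field, without its local-resolvability hypothesis.** In the exact unfolded shape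
of the registered stub of `Cruxes/LocalToGlobal/Lines/birth.lean` (crux
stmt-ResolutionOfSingularities-15232), with `hloc` replaced by `hT`: for `X` integral separated
of finite type over `𝔽_p = ZMod p`, opens `U ⊔ V = ⊤`, and proper birational integral models
`Z₁ → X` regular over `U`, `Z₂ → X` regular over `V`, the scheme `X` has a resolution.
[cite: Piltant2013, Prop. 5.1 (shape); Zariski1944, p. 539] -/
theorem openPatching_of_twoModelPatching (p : ℕ) (hp : p.Prime)
    (hT : ProperModel.TwoModelPatching.{0} p)
    (X : Scheme.{0}) (f : X ⟶ Spec (.of (ZMod p))) (hs : IsSeparated f)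
    (hl : LocallyOfFiniteType f) (hq : QuasiCompact f) (hi : IsIntegral X) (U V : X.Opens)
    (hUV : U ⊔ V = ⊤)
    (hU : ∃ (Z : Scheme.{0}) (π : Z ⟶ X), IsIntegral Z ∧ IsProper π ∧ IsBirational π ∧
      ∀ z : Z, π.base z ∈ U → IsRegularLocalRing (Z.presheaf.stalk z))
    (hV : ∃ (Z : Scheme.{0}) (π : Z ⟶ X), IsIntegral Z ∧ IsProper π ∧ IsBirational π ∧
      ∀ z : Z, π.base z ∈ V → IsRegularLocalRing (Z.presheaf.stalk z)) :
    Scheme.HasResolution X := by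
  haveI : Fact p.Prime := ⟨hp⟩
  haveI := hs; haveI := hl; haveI := hq; haveI := hi
  obtain ⟨Z₁, π₁, hZ₁, hπ₁, hb₁, hr₁⟩ := hU
  obtain ⟨Z₂, π₂, hZ₂, hπ₂, hb₂, hr₂⟩ := hV
  haveI := hZ₁; haveI := hπ₁; haveI := hZ₂; haveI := hπ₂
  exact hasResolution_of_twoModelPatching_of_cover (k := ZMod p) hT X f U V hUV π₁ π₂ hb₁ hb₂
    hr₁ hr₂

end Summit.ResolutionOfSingularities.ResolutionOfSingularities.Theorems

end
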